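import Mathlib.Geometry.Manifold.Instances.Sphere
import Mathlib.Geometry.Manifold.Diffeomorph
import HarnessLib

/-!
# The Möbius group of the sphere `Sⁿ` in the Lorentz (light-cone) model (proved)

Topic `Literature/Geometry/Conformal`. Infrastructure for Kuiper's theorem
(`Literature/Geometry/Riemannian/KuiperProofs.lean`, step 1: a locally conformally flat manifold
is an `(Sⁿ, Möb(n))`-manifold): the group of Möbius transformations of the unit sphere `S` of a
real inner product space `F`, realised as the orthochronous Lorentz group of `ℝ × F` with the
quadratic form `‖y‖² − t²` acting on the projectivised future light cone `{(1, y) : ‖y‖ = 1} ≅ S`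
(Benedetti–Petronio 1992, §A.3–A.4 use the hyperboloid/light-cone model `O(I_n)`; the
identification of `Conf(Sⁿ)` with `PO(n+1, 1)` is classical).

Everything here is PROVED:

* `Literature.Geometry.Conformal.lorentzForm`, `Literature.Conformal.lorentzGroup F`: the bilinear form
  `⟪y, y'⟫ − t t'` on `ℝ × F` and the subgroup of linear automorphisms of `ℝ × F` preserving it
  and mapping the future light cone to itself.
* the action `A • y = (A(1,y)).1⁻¹ • (A(1,y)).2` of `lorentzGroup F` on the unit sphere
  (`MulAction`), its smoothness (`contMDiff_moebius`) and the diffeomorphisms `moebiusDiffeo A`.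
* **rigidity** (`eq_of_smul_eventuallyEq`): two elements of the Lorentz group whose Möbius
  actions agree near one point of the sphere are equal (`dim F ≥ 2`).
* `Literature.Conformal.moebiusMaps F : Set (S → S)`, the set of Möbius transformations as self-maps
  of the sphere; it contains `id`, is closed under composition, consists of `C^∞`
  diffeomorphisms, and is rigid.

## References

* R. Benedetti, C. Petronio, *Lectures on Hyperbolic Geometry*, Springer 1992, §A.3 (conformal
  geometry, Liouville's theorem A.3.7) and Prop. A.2.1 / §B.1 p. 55 (unique continuation).
* N. H. Kuiper, *On conformally-flat spaces in the large*, Ann. of Math. (2) 50 (1949) 916–924.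
-/

noncomputable section

open Metric Module Function Set Filter
open scoped Manifold ContDiff Topology RealInnerProductSpace

namespace Literature.Geometry.Conformal

variable {F : Type*} [NormedAddCommGroup F] [InnerProductSpace ℝ F]

/-! ### The Lorentz form and the orthochronous Lorentz group of `ℝ × F` -/

/-- The Lorentz bilinear form `⟪y, y'⟫ − t t'` on `ℝ × F` (signature `(n+1, 1)` when
`dim F = n + 1`). [folklore] -/
def lorentzForm (u v : ℝ × F) : ℝ :=
  ⟪u.2, v.2⟫ - u.1 * v.1

/-- The Lorentz form is symmetric. [folklore] -/
theorem lorentzForm_comm (u v : ℝ × F) : lorentzForm u v = lorentzForm v u := by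
  unfold lorentzForm
  rw [real_inner_comm, mul_comm]

/-- `Q(t, y) = ‖y‖² − t²`. [folklore] -/
theorem lorentzForm_self (u : ℝ × F) : lorentzForm u u = ‖u.2‖ ^ 2 - u.1 ^ 2 := by
  unfold lorentzForm
  rw [real_inner_self_eq_norm_sq, sq u.1]

/-- The vectors `(1, y)`, `‖y‖ = 1`, are null. [folklore] -/
theorem lorentzForm_one_sphere (y : sphere (0 : F) 1) :
    lorentzForm ((1 : ℝ), (y : F)) ((1 : ℝ), (y : F)) = 0 := by
  rw [lorentzForm_self, norm_eq_of_mem_sphere]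
  ring

/-- `Q((1, y), (1, y')) = ⟪y, y'⟫ − 1`. [folklore] -/
theorem lorentzForm_one_one (y y' : F) :
    lorentzForm ((1 : ℝ), y) ((1 : ℝ), y') = ⟪y, y'⟫ - 1 := by
  simp [lorentzForm]

/-- The Lorentz form is additive in the first variable. [folklore] -/
theorem lorentzForm_add_left (u u' v : ℝ × F) :
    lorentzForm (u + u') v = lorentzForm u v + lorentzForm u' v := by
  simp only [lorentzForm, Prod.snd_add, Prod.fst_add, inner_add_left]
  ring

/-- The Lorentz form is homogeneous in the first variable. [folklore] -/
theorem lorentzForm_smul_left (c : ℝ) (u v : ℝ × F) :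
    lorentzForm (c • u) v = c * lorentzForm u v := by
  simp only [lorentzForm, Prod.smul_snd, Prod.smul_fst, smul_eq_mul, real_inner_smul_left]
  ring

/-- The Lorentz form is homogeneous in the second variable. [folklore] -/
theorem lorentzForm_smul_right (c : ℝ) (u v : ℝ × F) :
    lorentzForm u (c • v) = c * lorentzForm u v := by
  rw [lorentzForm_comm, lorentzForm_smul_left, lorentzForm_comm]

/-- The Lorentz form is negation-invariant. [folklore] -/
theorem lorentzForm_neg_neg (u v : ℝ × F) : lorentzForm (-u) (-v) = lorentzForm u v := by
  simp [lorentzForm]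

/-- A future null vector `v = (t, z)`, `t > 0`, `‖z‖² = t²`, is `t • (1, y)` with `‖y‖ = 1`,
namely `y = t⁻¹ • z`. [folklore] -/
theorem norm_smul_inv_eq_one {v : ℝ × F} (hv : lorentzForm v v = 0) (ht : 0 < v.1) :
    ‖v.1⁻¹ • v.2‖ = 1 := by
  rw [lorentzForm_self, sub_eq_zero] at hv
  have h1 : ‖v.2‖ = v.1 := by
    have := (sq_eq_sq₀ (norm_nonneg _) ht.le).mp hv
    exact this
  rw [norm_smul, norm_inv, Real.norm_eq_abs, abs_of_pos ht, h1, inv_mul_cancel₀ ht.ne']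

/-- Decomposition of a future null vector: `v = v.1 • (1, v.1⁻¹ • v.2)`. [folklore] -/
theorem eq_smul_one_smul {v : ℝ × F} (ht : v.1 ≠ 0) :
    v = v.1 • ((1 : ℝ), v.1⁻¹ • v.2) := by
  ext
  · simp
  · simp [smul_smul, mul_inv_cancel₀ ht]

variable (F) in
/-- The **orthochronous Lorentz group** of `ℝ × F`: linear automorphisms preserving the Lorentz
form `⟪y, y'⟫ − t t'` and mapping the future light cone `{t (1, y) : t > 0, ‖y‖ = 1}` into
itself. For `F = ℝⁿ⁺¹` this is `O⁺(n+1, 1)`, whose action on the projectivised light cone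
`≅ Sⁿ` is the Möbius group of `Sⁿ`. [folklore] -/
def lorentzGroup : Subgroup ((ℝ × F) ≃ₗ[ℝ] (ℝ × F)) where
  carrier := {A | (∀ u v, lorentzForm (A u) (A v) = lorentzForm u v) ∧
    ∀ y : F, ‖y‖ = 1 → 0 < (A ((1 : ℝ), y)).1}
  one_mem' := ⟨fun u v => rfl, fun y hy => by simp⟩
  mul_mem' := by
    rintro A B ⟨hA, hA'⟩ ⟨hB, hB'⟩
    refine ⟨fun u v => by rw [LinearEquiv.mul_eq_trans, LinearEquiv.trans_apply,
      LinearEquiv.trans_apply, hA, hB], fun y hy => ?_⟩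
    rw [LinearEquiv.mul_eq_trans, LinearEquiv.trans_apply]
    set v := B ((1 : ℝ), y) with hv
    have ht : 0 < v.1 := hB' y hy
    have hnull : lorentzForm v v = 0 := by
      rw [hv, hB, lorentzForm_self, hy]
      norm_num
    rw [eq_smul_one_smul ht.ne', LinearEquiv.map_smul, Prod.smul_fst, smul_eq_mul]
    exact mul_pos ht (hA' _ (norm_smul_inv_eq_one hnull ht))
  inv_mem' := by
    rintro A ⟨hA, hA'⟩
    have hform : ∀ u v, lorentzForm (A⁻¹ u) (A⁻¹ v) = lorentzForm u v := fun u v => by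
      have := hA (A⁻¹ u) (A⁻¹ v)
      simp only [LinearEquiv.coe_inv, LinearEquiv.apply_symm_apply] at this
      exact this.symm
    refine ⟨hform, fun y hy => ?_⟩
    set v := A⁻¹ ((1 : ℝ), y) with hv
    have hAv : A v = ((1 : ℝ), y) := by simp [hv]
    have hnull : lorentzForm v v = 0 := by
      rw [hv, hform, lorentzForm_self, hy]
      norm_num
    rcases lt_trichotomy 0 v.1 with ht | ht | ht
    · exact ht
    · exfalso
      have hz : v.2 = 0 := by
        rw [lorentzForm_self, ← ht] at hnull
        simpa using hnull
      have hv0 : v = 0 := Prod.ext ht.symm hz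
      have : ((1 : ℝ), y) = (0 : ℝ × F) := by rw [← hAv, hv0, map_zero]
      simpa using congrArg Prod.fst this
    · exfalso
      have ht' : 0 < (-v).1 := by simpa using ht
      have hnull' : lorentzForm (-v) (-v) = 0 := by rw [lorentzForm_neg_neg]; exact hnull
      have hpos := hA' _ (norm_smul_inv_eq_one hnull' ht')
      have key : A (-v) = (-v).1 • A ((1 : ℝ), (-v).1⁻¹ • (-v).2) := by
        conv_lhs => rw [eq_smul_one_smul ht'.ne']
        rw [LinearEquiv.map_smul]
      have h1 : (A (-v)).1 = -1 := by rw [map_neg, hAv]; rfl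
      rw [key, Prod.smul_fst, smul_eq_mul] at h1
      have : 0 < (-v).1 * (A ((1 : ℝ), (-v).1⁻¹ • (-v).2)).1 := mul_pos ht' hpos
      linarith

/-- Elements of the Lorentz group preserve the Lorentz form. [folklore] -/
theorem lorentzForm_apply_apply (A : lorentzGroup F) (u v : ℝ × F) :
    lorentzForm ((A : (ℝ × F) ≃ₗ[ℝ] (ℝ × F)) u) ((A : (ℝ × F) ≃ₗ[ℝ] (ℝ × F)) v) =
      lorentzForm u v :=
  A.2.1 u v

/-- Elements of the Lorentz group map `(1, y)`, `‖y‖ = 1`, into the future (`t > 0`).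
[folklore] -/
theorem fst_apply_pos (A : lorentzGroup F) {y : F} (hy : ‖y‖ = 1) :
    0 < ((A : (ℝ × F) ≃ₗ[ℝ] (ℝ × F)) ((1 : ℝ), y)).1 :=
  A.2.2 y hy

/-! ### The Möbius action on the sphere -/

/-- The image of the null line through `(1, y)` under `A` is the null line through
`(1, A • y)`: the **Möbius action** `A • y := (A(1,y)).1⁻¹ • (A(1,y)).2` of the Lorentz group on
the unit sphere. [folklore] -/
def moebius (A : lorentzGroup F) (y : sphere (0 : F) 1) : sphere (0 : F) 1 :=
  ⟨((A : (ℝ × F) ≃ₗ[ℝ] (ℝ × F)) ((1 : ℝ), (y : F))).1⁻¹ •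
      ((A : (ℝ × F) ≃ₗ[ℝ] (ℝ × F)) ((1 : ℝ), (y : F))).2, by
    rw [mem_sphere_zero_iff_norm]
    refine norm_smul_inv_eq_one ?_ (fst_apply_pos A (norm_eq_of_mem_sphere y))
    rw [lorentzForm_apply_apply, lorentzForm_one_sphere]⟩

/-- The value of the Möbius action as a vector of `F`. [folklore] -/
theorem coe_moebius (A : lorentzGroup F) (y : sphere (0 : F) 1) :
    (moebius A y : F) = ((A : (ℝ × F) ≃ₗ[ℝ] (ℝ × F)) ((1 : ℝ), (y : F))).1⁻¹ •
      ((A : (ℝ × F) ≃ₗ[ℝ] (ℝ × F)) ((1 : ℝ), (y : F))).2 :=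
  rfl

/-- Defining relation of the Möbius action: `A (1, y) = (A(1,y)).1 • (1, A • y)`. [folklore] -/
theorem apply_one_eq_smul (A : lorentzGroup F) (y : sphere (0 : F) 1) :
    (A : (ℝ × F) ≃ₗ[ℝ] (ℝ × F)) ((1 : ℝ), (y : F)) =
      ((A : (ℝ × F) ≃ₗ[ℝ] (ℝ × F)) ((1 : ℝ), (y : F))).1 • ((1 : ℝ), (moebius A y : F)) :=
  eq_smul_one_smul (fst_apply_pos A (norm_eq_of_mem_sphere y)).ne'

/-- The identity acts trivially. [folklore] -/
theorem moebius_one (y : sphere (0 : F) 1) : moebius (1 : lorentzGroup F) y = y := by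
  ext1
  simp [coe_moebius]

/-- The Möbius action is multiplicative. [folklore] -/
theorem moebius_mul (A B : lorentzGroup F) (y : sphere (0 : F) 1) :
    moebius (A * B) y = moebius A (moebius B y) := by
  ext1
  set t := ((B : (ℝ × F) ≃ₗ[ℝ] (ℝ × F)) ((1 : ℝ), (y : F))).1 with ht
  have htpos : 0 < t := fst_apply_pos B (norm_eq_of_mem_sphere y)
  have hAB : ((A * B : lorentzGroup F) : (ℝ × F) ≃ₗ[ℝ] (ℝ × F)) ((1 : ℝ), (y : F)) =
      t • (A : (ℝ × F) ≃ₗ[ℝ] (ℝ × F)) ((1 : ℝ), (moebius B y : F)) := by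
    rw [Subgroup.coe_mul, LinearEquiv.mul_eq_trans, LinearEquiv.trans_apply,
      apply_one_eq_smul B y, LinearEquiv.map_smul]
  rw [coe_moebius, coe_moebius, hAB, Prod.smul_fst, Prod.smul_snd, smul_eq_mul, mul_inv,
    smul_smul, mul_comm t⁻¹, mul_assoc, ← smul_smul, ← smul_smul, smul_smul t⁻¹ t,
    inv_mul_cancel₀ htpos.ne', one_smul]

/-- The Möbius action of the orthochronous Lorentz group on the unit sphere. [folklore] -/
instance : MulAction (lorentzGroup F) (sphere (0 : F) 1) where
  smul := moebius
  one_smul := moebius_one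
  mul_smul := moebius_mul

/-- `A • y` is the Möbius action. [folklore] -/
theorem smul_def (A : lorentzGroup F) (y : sphere (0 : F) 1) : A • y = moebius A y := rfl

/-- If `A • y = y` then `(1, y)` is an eigenvector of `A` with eigenvalue `(A(1,y)).1 > 0`.
[folklore] -/
theorem apply_one_eq_smul_of_smul_eq (A : lorentzGroup F) {y : sphere (0 : F) 1}
    (h : A • y = y) :
    (A : (ℝ × F) ≃ₗ[ℝ] (ℝ × F)) ((1 : ℝ), (y : F)) =
      ((A : (ℝ × F) ≃ₗ[ℝ] (ℝ × F)) ((1 : ℝ), (y : F))).1 • ((1 : ℝ), (y : F)) := by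
  conv_lhs => rw [apply_one_eq_smul A y]
  rw [← smul_def, h]

/-! ### Smoothness: Möbius transformations are diffeomorphisms of the sphere -/

section Smooth

variable {n : ℕ} [Fact (finrank ℝ F = n + 1)]

/-- The Möbius map as a map of the ambient space `F` (meaningful off the hyperplane
`(A(1,z)).1 = 0`, which misses the sphere). [folklore] -/
def moebiusAux (A : lorentzGroup F) (z : F) : F :=
  ((A : (ℝ × F) ≃ₗ[ℝ] (ℝ × F)) ((1 : ℝ), z)).1⁻¹ • ((A : (ℝ × F) ≃ₗ[ℝ] (ℝ × F)) ((1 : ℝ), z)).2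

omit [Fact (finrank ℝ F = n + 1)] in
/-- On the sphere, `moebiusAux` is the Möbius action. [folklore] -/
theorem moebiusAux_coe (A : lorentzGroup F) (y : sphere (0 : F) 1) :
    moebiusAux A y = (A • y : sphere (0 : F) 1) :=
  rfl

/-- `moebiusAux A` is smooth off the hyperplane `(A(1,z)).1 = 0` (finite-dimensional `F`).
[folklore] -/
theorem contDiffAt_moebiusAux [FiniteDimensional ℝ F] (A : lorentzGroup F) {z : F}
    (hz : ((A : (ℝ × F) ≃ₗ[ℝ] (ℝ × F)) ((1 : ℝ), z)).1 ≠ 0) :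
    ContDiffAt ℝ ∞ (moebiusAux A) z := by
  set L : (ℝ × F) →L[ℝ] (ℝ × F) :=
    LinearMap.toContinuousLinearMap ((A : (ℝ × F) ≃ₗ[ℝ] (ℝ × F)) : (ℝ × F) →ₗ[ℝ] (ℝ × F))
    with hL
  have hLA : ∀ v, L v = (A : (ℝ × F) ≃ₗ[ℝ] (ℝ × F)) v := fun v => rfl
  have h1 : ContDiff ℝ ∞ (fun z : F => (A : (ℝ × F) ≃ₗ[ℝ] (ℝ × F)) ((1 : ℝ), z)) := by
    have : (fun z : F => (A : (ℝ × F) ≃ₗ[ℝ] (ℝ × F)) ((1 : ℝ), z)) =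
        fun z : F => L ((1 : ℝ), z) := by
      funext z; rw [hLA]
    rw [this]
    exact L.contDiff.comp (contDiff_const.prodMk contDiff_id)
  have h2 : ContDiffAt ℝ ∞ (fun z : F => ((A : (ℝ × F) ≃ₗ[ℝ] (ℝ × F)) ((1 : ℝ), z)).1) z :=
    (contDiff_fst.comp h1).contDiffAt
  have h3 : ContDiffAt ℝ ∞ (fun z : F => ((A : (ℝ × F) ≃ₗ[ℝ] (ℝ × F)) ((1 : ℝ), z)).2) z :=
    (contDiff_snd.comp h1).contDiffAt
  exact (h2.inv hz).smul h3

/-- **Möbius transformations are smooth** self-maps of the sphere (with Mathlib's analytic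
manifold structure given by stereographic charts). [folklore] -/
theorem contMDiff_smul (A : lorentzGroup F) :
    ContMDiff (𝓡 n) (𝓡 n) ∞ (fun y : sphere (0 : F) 1 => A • y) := by
  haveI : FiniteDimensional ℝ F := .of_fact_finrank_eq_succ n
  have h : ContMDiff (𝓡 n) 𝓘(ℝ, F) ∞ (fun y : sphere (0 : F) 1 => moebiusAux A y) := fun y =>
    ((contDiffAt_moebiusAux A (fst_apply_pos A (norm_eq_of_mem_sphere y)).ne').contMDiffAt).comp
      y contMDiff_coe_sphere.contMDiffAt
  exact h.codRestrict_sphere fun y => (A • y).2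

/-- The **Möbius transformation** `y ↦ A • y` as a `C^∞` diffeomorphism of the sphere, with
inverse `y ↦ A⁻¹ • y`. [folklore] -/
def moebiusDiffeo (A : lorentzGroup F) :
    Diffeomorph (𝓡 n) (𝓡 n) (sphere (0 : F) 1) (sphere (0 : F) 1) ∞ where
  toEquiv := MulAction.toPerm A
  contMDiff_toFun := contMDiff_smul A
  contMDiff_invFun := contMDiff_smul A⁻¹

/-- `moebiusDiffeo A` is `y ↦ A • y`. [folklore] -/
@[simp]
theorem moebiusDiffeo_apply (A : lorentzGroup F) (y : sphere (0 : F) 1) :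
    moebiusDiffeo (n := n) A y = A • y :=
  rfl

/-- `moebiusDiffeo A` is `y ↦ A • y` as a function. [folklore] -/
theorem coe_moebiusDiffeo (A : lorentzGroup F) :
    ⇑(moebiusDiffeo (n := n) A) = fun y : sphere (0 : F) 1 => A • y :=
  rfl

end Smooth

/-! ### Rigidity: a Möbius transformation is determined by its germ at one point -/

section Rigid

/-- If `A` fixes two distinct points `y ≠ y'` of the sphere then the eigenvalues of `A` on
`(1, y)` and `(1, y')` are inverse to each other (`Q((1,y),(1,y')) = ⟪y,y'⟫ − 1 ≠ 0` is
preserved). [folklore] -/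
theorem fst_mul_fst_eq_one (A : lorentzGroup F) {y y' : sphere (0 : F) 1} (hy : A • y = y)
    (hy' : A • y' = y') (hne : y ≠ y') :
    ((A : (ℝ × F) ≃ₗ[ℝ] (ℝ × F)) ((1 : ℝ), (y : F))).1 *
      ((A : (ℝ × F) ≃ₗ[ℝ] (ℝ × F)) ((1 : ℝ), (y' : F))).1 = 1 := by
  have h := lorentzForm_apply_apply A ((1 : ℝ), (y : F)) ((1 : ℝ), (y' : F))
  rw [apply_one_eq_smul_of_smul_eq A hy, apply_one_eq_smul_of_smul_eq A hy',
    lorentzForm_smul_left, lorentzForm_smul_right, lorentzForm_one_one, ← mul_assoc] at h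
  have hne' : ⟪(y : F), (y' : F)⟫ - 1 ≠ 0 := by
    have hlt : ⟪(y : F), (y' : F)⟫ < 1 :=
      (inner_lt_one_iff_real_of_norm_eq_one (norm_eq_of_mem_sphere y)
        (norm_eq_of_mem_sphere y')).mpr fun h => hne (Subtype.ext h)
    linarith
  have := mul_right_cancel₀ hne' (h.trans (one_mul _).symm)
  exact this

/-- If `A` fixes three distinct points `y₁, y₂, y₃` of the sphere then `A (1, y₁) = (1, y₁)`.
[folklore] -/
theorem apply_one_eq_self_of_three (A : lorentzGroup F) {y₁ y₂ y₃ : sphere (0 : F) 1}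
    (h₁ : A • y₁ = y₁) (h₂ : A • y₂ = y₂) (h₃ : A • y₃ = y₃) (h₁₂ : y₁ ≠ y₂) (h₁₃ : y₁ ≠ y₃)
    (h₂₃ : y₂ ≠ y₃) :
    (A : (ℝ × F) ≃ₗ[ℝ] (ℝ × F)) ((1 : ℝ), (y₁ : F)) = ((1 : ℝ), (y₁ : F)) := by
  have e12 := fst_mul_fst_eq_one A h₁ h₂ h₁₂
  have e13 := fst_mul_fst_eq_one A h₁ h₃ h₁₃
  have e23 := fst_mul_fst_eq_one A h₂ h₃ h₂₃
  set a := ((A : (ℝ × F) ≃ₗ[ℝ] (ℝ × F)) ((1 : ℝ), (y₁ : F))).1 with ha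
  have hapos : 0 < a := fst_apply_pos A (norm_eq_of_mem_sphere y₁)
  have hsq : a * a = 1 := by
    linear_combination (-(a * a)) * e23 +
      (a * ((A : (ℝ × F) ≃ₗ[ℝ] (ℝ × F)) ((1 : ℝ), (y₃ : F))).1) * e12 + e13
  have ha1 : a = 1 := by
    have : (a - 1) * (a + 1) = 0 := by ring_nf; linarith
    rcases mul_eq_zero.mp this with h | h
    · linarith
    · linarith
  rw [apply_one_eq_smul_of_smul_eq A h₁, ← ha, ha1, one_smul]

/-- The point `c • p + s • u` of the sphere, for `p` on the sphere, `u` a unit vector orthogonal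
to `p` and `c² + s² = 1`. [folklore] -/
def circlePoint (p : sphere (0 : F) 1) (u : F) (c s : ℝ) (hu : ‖u‖ = 1)
    (hpu : ⟪(p : F), u⟫ = 0) (hcs : c ^ 2 + s ^ 2 = 1) : sphere (0 : F) 1 :=
  ⟨c • (p : F) + s • u, by
    rw [mem_sphere_zero_iff_norm, ← sq_eq_sq₀ (norm_nonneg _) zero_le_one, one_pow,
      norm_add_sq_real, norm_smul, norm_smul, real_inner_smul_left, real_inner_smul_right, hpu,
      norm_eq_of_mem_sphere, hu, Real.norm_eq_abs, Real.norm_eq_abs, mul_one, mul_one, sq_abs,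
      sq_abs]
    linarith⟩

/-- The value of `circlePoint`. [folklore] -/
@[simp]
theorem coe_circlePoint (p : sphere (0 : F) 1) (u : F) (c s : ℝ) (hu : ‖u‖ = 1)
    (hpu : ⟪(p : F), u⟫ = 0) (hcs : c ^ 2 + s ^ 2 = 1) :
    (circlePoint p u c s hu hpu hcs : F) = c • (p : F) + s • u :=
  rfl

/-- `circlePoint p u c s ≠ p` when `c ≠ 1`. [folklore] -/
theorem circlePoint_ne (p : sphere (0 : F) 1) (u : F) (c s : ℝ) (hu : ‖u‖ = 1)
    (hpu : ⟪(p : F), u⟫ = 0) (hcs : c ^ 2 + s ^ 2 = 1) (hc : c ≠ 1) :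
    circlePoint p u c s hu hpu hcs ≠ p := by
  intro h
  have h' : ⟪(p : F), (circlePoint p u c s hu hpu hcs : F)⟫ = 1 := by
    rw [h, real_inner_self_eq_norm_sq, norm_eq_of_mem_sphere, one_pow]
  rw [coe_circlePoint, inner_add_right, real_inner_smul_right, real_inner_smul_right, hpu,
    real_inner_self_eq_norm_sq, norm_eq_of_mem_sphere] at h'
  apply hc
  linarith

/-- `circlePoint p u c s ≠ circlePoint p (-u) c s` when `s ≠ 0`. [folklore] -/
theorem circlePoint_ne_neg (p : sphere (0 : F) 1) (u : F) (c s : ℝ) (hu : ‖u‖ = 1)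
    (hpu : ⟪(p : F), u⟫ = 0) (hcs : c ^ 2 + s ^ 2 = 1) (hs : s ≠ 0) (hu' : ‖-u‖ = 1)
    (hpu' : ⟪(p : F), -u⟫ = 0) :
    circlePoint p u c s hu hpu hcs ≠ circlePoint p (-u) c s hu' hpu' hcs := by
  intro h
  have h' := congrArg (fun y : sphere (0 : F) 1 => (y : F)) h
  simp only [coe_circlePoint, smul_neg, add_right_inj] at h'
  have h2 : (2 * s) • u = 0 := by rw [mul_smul, two_smul]; nth_rw 2 [h']; simp
  rcases smul_eq_zero.mp h2 with h3 | h3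
  · exact hs (by linarith)
  · rw [h3, norm_zero] at hu
    exact zero_ne_one hu

/-- Every neighbourhood of `p` in the sphere contains a whole "circle of latitude"
`{c • p + s • u : u ⊥ p, ‖u‖ = 1}` with `s ≠ 0`, `c ≠ 1`. [folklore] -/
theorem exists_circle_subset {p : sphere (0 : F) 1} {W : Set (sphere (0 : F) 1)}
    (hW : W ∈ 𝓝 p) :
    ∃ c s : ℝ, ∃ hcs : c ^ 2 + s ^ 2 = 1, s ≠ 0 ∧ c ≠ 1 ∧
      ∀ (u : F) (hu : ‖u‖ = 1) (hpu : ⟪(p : F), u⟫ = 0), circlePoint p u c s hu hpu hcs ∈ W := by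
  obtain ⟨ε, hε, hball⟩ := Metric.mem_nhds_iff.mp hW
  set a : ℝ := min (ε / 4) (1 / 2) with ha
  have ha0 : 0 < a := lt_min (by linarith) (by norm_num)
  have haε : a ≤ ε / 4 := min_le_left _ _
  have hd : 0 < 1 + a ^ 2 := by positivity
  refine ⟨(1 - a ^ 2) / (1 + a ^ 2), 2 * a / (1 + a ^ 2), ?_, ?_, ?_, fun u hu hpu => ?_⟩
  · field_simp
    ring
  · exact div_ne_zero (by linarith) hd.ne'
  · intro h
    rw [div_eq_one_iff_eq hd.ne'] at h
    nlinarith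
  · apply hball
    rw [Metric.mem_ball, Subtype.dist_eq, dist_eq_norm, coe_circlePoint]
    have hsq : ‖((1 - a ^ 2) / (1 + a ^ 2)) • (p : F) + (2 * a / (1 + a ^ 2)) • u - p‖ ^ 2 =
        4 * a ^ 2 / (1 + a ^ 2) := by
      have : ((1 - a ^ 2) / (1 + a ^ 2)) • (p : F) + (2 * a / (1 + a ^ 2)) • u - p =
          ((1 - a ^ 2) / (1 + a ^ 2) - 1) • (p : F) + (2 * a / (1 + a ^ 2)) • u := by
        rw [sub_smul, one_smul]; abel
      rw [this, norm_add_sq_real, norm_smul, norm_smul, real_inner_smul_left,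
        real_inner_smul_right, hpu, norm_eq_of_mem_sphere, hu, Real.norm_eq_abs,
        Real.norm_eq_abs, mul_one, mul_one, sq_abs, sq_abs]
      field_simp
      ring
    have hle : 4 * a ^ 2 / (1 + a ^ 2) ≤ (2 * a) ^ 2 := by
      rw [div_le_iff₀ hd]
      nlinarith
    have hlt : (2 * a) ^ 2 < ε ^ 2 := by nlinarith
    have h := lt_of_le_of_lt (hsq.le.trans hle) hlt
    exact lt_of_pow_lt_pow_left₀ 2 hε.le h

variable {n : ℕ} [Fact (finrank ℝ F = n + 1)]

/-- For `dim F ≥ 2` there is a unit vector orthogonal to a given point of the sphere.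
[folklore] -/
theorem exists_unit_orthogonal (hn : 1 ≤ n) (p : sphere (0 : F) 1) :
    ∃ u : F, ‖u‖ = 1 ∧ ⟪(p : F), u⟫ = 0 := by
  haveI : Nontrivial (ℝ ∙ (p : F))ᗮ := by
    apply Module.nontrivial_of_finrank_pos (R := ℝ)
    rw [Submodule.finrank_orthogonal_span_singleton (𝕜 := ℝ) (n := n)
      (ne_zero_of_mem_unit_sphere p)]
    omega
  obtain ⟨w, hw⟩ := exists_ne (0 : (ℝ ∙ (p : F))ᗮ)
  have hw' : (w : F) ≠ 0 := fun h => hw (Subtype.ext h)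
  have hpw : ⟪(p : F), (w : F)⟫ = 0 :=
    Submodule.mem_orthogonal_singleton_iff_inner_right.mp w.2
  refine ⟨‖(w : F)‖⁻¹ • (w : F), ?_, ?_⟩
  · rw [norm_smul, norm_inv, norm_norm, inv_mul_cancel₀ (norm_ne_zero_iff.mpr hw')]
  · rw [real_inner_smul_right, hpw, mul_zero]

/-- **Rigidity of Möbius transformations, fixed-point form.** If `A • y = y` for all `y` in a
neighbourhood of a point of the sphere (`dim F ≥ 2`), then `A = 1`: the eigenvalues on the fixed
null lines are `1` by the three-point argument, and the null vectors `(1, y)`, `y` near `p`,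
span `ℝ × F`. [cite: BenedettiPetronio1992, §B.1 p. 55 (analytic continuation principle)] -/
theorem eq_one_of_smul_eventuallyEq (hn : 1 ≤ n) {A : lorentzGroup F} {p : sphere (0 : F) 1}
    (h : ∀ᶠ y in 𝓝 p, A • y = y) : A = 1 := by
  obtain ⟨c, s, hcs, hs, hc, hmem⟩ := exists_circle_subset (W := {y | A • y = y}) h
  obtain ⟨u₀, hu₀, hpu₀⟩ := exists_unit_orthogonal hn p
  have hp : A • p = p := (show p ∈ {y | A • y = y} from mem_of_mem_nhds h)
  -- notation for the circle points
  have hneg : ∀ u : F, ‖u‖ = 1 → ‖-u‖ = 1 := fun u hu => by rw [norm_neg, hu]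
  have hneg' : ∀ u : F, ⟪(p : F), u⟫ = 0 → ⟪(p : F), -u⟫ = 0 := fun u hpu => by
    rw [inner_neg_right, hpu, neg_zero]
  set Y : ∀ (u : F), ‖u‖ = 1 → ⟪(p : F), u⟫ = 0 → sphere (0 : F) 1 :=
    fun u hu hpu => circlePoint p u c s hu hpu hcs with hY
  have hfix : ∀ u hu hpu, A • Y u hu hpu = Y u hu hpu := fun u hu hpu => hmem u hu hpu
  have hYp : ∀ u hu hpu, Y u hu hpu ≠ p := fun u hu hpu => circlePoint_ne p u c s hu hpu hcs hc
  have hYY : ∀ u hu hpu, Y u hu hpu ≠ Y (-u) (hneg u hu) (hneg' u hpu) := fun u hu hpu =>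
    circlePoint_ne_neg p u c s hu hpu hcs hs _ _
  set L := (A : (ℝ × F) ≃ₗ[ℝ] (ℝ × F)) with hL
  -- `A` fixes `(1, p)` and `(1, Y u)`
  have hLp : L ((1 : ℝ), (p : F)) = ((1 : ℝ), (p : F)) :=
    apply_one_eq_self_of_three A hp (hfix u₀ hu₀ hpu₀) (hfix (-u₀) (hneg u₀ hu₀) (hneg' u₀ hpu₀))
      (hYp u₀ hu₀ hpu₀).symm (hYp _ _ _).symm (hYY u₀ hu₀ hpu₀)
  have hLY : ∀ u hu hpu, L ((1 : ℝ), (Y u hu hpu : F)) = ((1 : ℝ), (Y u hu hpu : F)) :=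
    fun u hu hpu =>
    apply_one_eq_self_of_three A (hfix u hu hpu) hp (hfix (-u) (hneg u hu) (hneg' u hpu))
      (hYp u hu hpu) (hYY u hu hpu) (hYp _ _ _).symm
  -- hence `(0, u)` for `u ⊥ p`
  have hLu1 : ∀ u : F, ‖u‖ = 1 → ⟪(p : F), u⟫ = 0 → L ((0 : ℝ), u) = ((0 : ℝ), u) := by
    intro u hu hpu
    have h1 := hLY u hu hpu
    have h2 := hLY (-u) (hneg u hu) (hneg' u hpu)
    have hdiff : ((1 : ℝ), (Y u hu hpu : F)) - ((1 : ℝ), (Y (-u) (hneg u hu) (hneg' u hpu) : F)) =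
        (2 * s) • ((0 : ℝ), u) := by
      refine Prod.ext (by simp) ?_
      show (c • (p : F) + s • u) - (c • (p : F) + s • (-u)) = (2 * s) • u
      rw [smul_neg, mul_smul, two_smul]
      abel
    have h3 : L (((1 : ℝ), (Y u hu hpu : F)) - ((1 : ℝ), (Y (-u) (hneg u hu) (hneg' u hpu) : F))) =
        ((1 : ℝ), (Y u hu hpu : F)) - ((1 : ℝ), (Y (-u) (hneg u hu) (hneg' u hpu) : F)) := by
      rw [map_sub, h1, h2]
    rw [hdiff, LinearEquiv.map_smul] at h3
    exact smul_right_injective _ (mul_ne_zero two_ne_zero hs) h3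
  have hLu : ∀ w : F, ⟪(p : F), w⟫ = 0 → L ((0 : ℝ), w) = ((0 : ℝ), w) := by
    intro w hpw
    by_cases hw : w = 0
    · subst hw
      rw [show ((0 : ℝ), (0 : F)) = (0 : ℝ × F) from rfl, map_zero]
    · have hnorm : ‖w‖ ≠ 0 := norm_ne_zero_iff.mpr hw
      have hu : ‖‖w‖⁻¹ • w‖ = 1 := by
        rw [norm_smul, norm_inv, norm_norm, inv_mul_cancel₀ hnorm]
      have hpu : ⟪(p : F), ‖w‖⁻¹ • w⟫ = 0 := by rw [real_inner_smul_right, hpw, mul_zero]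
      have h1 := hLu1 _ hu hpu
      have hw' : ((0 : ℝ), w) = ‖w‖ • ((0 : ℝ), ‖w‖⁻¹ • w) := by
        ext
        · simp
        · simp [smul_smul, mul_inv_cancel₀ hnorm]
      rw [hw', LinearEquiv.map_smul, h1]
  -- and `(0, p)`, `(1, 0)`
  have hL0p : L ((0 : ℝ), (p : F)) = ((0 : ℝ), (p : F)) := by
    have h1 := hLY u₀ hu₀ hpu₀
    have h2 := hLY (-u₀) (hneg u₀ hu₀) (hneg' u₀ hpu₀)
    have hsum : ((1 : ℝ), (Y u₀ hu₀ hpu₀ : F)) + ((1 : ℝ), (Y (-u₀) (hneg u₀ hu₀) (hneg' u₀ hpu₀) : F))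
        - (2 : ℝ) • ((1 : ℝ), (p : F)) = (2 * (c - 1)) • ((0 : ℝ), (p : F)) := by
      refine Prod.ext ?_ ?_
      · simp; norm_num
      · show (c • (p : F) + s • u₀) + (c • (p : F) + s • (-u₀)) - (2 : ℝ) • (p : F) =
          (2 * (c - 1)) • (p : F)
        rw [smul_neg, mul_smul, two_smul, two_smul, sub_smul, one_smul]
        abel
    have h3 : L (((1 : ℝ), (Y u₀ hu₀ hpu₀ : F)) + ((1 : ℝ), (Y (-u₀) (hneg u₀ hu₀) (hneg' u₀ hpu₀) : F))
        - (2 : ℝ) • ((1 : ℝ), (p : F))) = ((1 : ℝ), (Y u₀ hu₀ hpu₀ : F)) +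
        ((1 : ℝ), (Y (-u₀) (hneg u₀ hu₀) (hneg' u₀ hpu₀) : F)) - (2 : ℝ) • ((1 : ℝ), (p : F)) := by
      rw [map_sub, map_add, LinearEquiv.map_smul, h1, h2, hLp]
    rw [hsum, LinearEquiv.map_smul] at h3
    exact smul_right_injective _ (mul_ne_zero two_ne_zero (sub_ne_zero.mpr hc)) h3
  have hL10 : L ((1 : ℝ), (0 : F)) = ((1 : ℝ), (0 : F)) := by
    have : ((1 : ℝ), (0 : F)) = ((1 : ℝ), (p : F)) - ((0 : ℝ), (p : F)) := by ext <;> simp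
    rw [this, map_sub, hLp, hL0p]
  -- conclusion by linearity: `(t, z) = t (1, 0) + ⟪p, z⟫ (0, p) + (0, z - ⟪p, z⟫ p)`
  apply Subtype.ext
  refine LinearEquiv.ext fun v => ?_
  obtain ⟨t, z⟩ := v
  have hw : ⟪(p : F), z - ⟪(p : F), z⟫ • (p : F)⟫ = 0 := by
    rw [inner_sub_right, real_inner_smul_right, real_inner_self_eq_norm_sq,
      norm_eq_of_mem_sphere, one_pow, mul_one, sub_self]
  have hdec : ((t, z) : ℝ × F) = t • ((1 : ℝ), (0 : F)) + ⟪(p : F), z⟫ • ((0 : ℝ), (p : F)) +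
      ((0 : ℝ), z - ⟪(p : F), z⟫ • (p : F)) := by
    ext
    · simp
    · simp
  change L (t, z) = (t, z)
  rw [hdec, map_add, map_add, LinearEquiv.map_smul, LinearEquiv.map_smul, hL10, hL0p, hLu _ hw]

/-- **Rigidity of Möbius transformations** (unique continuation; Benedetti–Petronio 1992,
§B.1, p. 55, "analytic continuation principle" for groups of analytic diffeomorphisms): two
elements of the Lorentz group whose Möbius actions agree in a neighbourhood of one point of the
sphere are equal (`dim F ≥ 2`). [cite: BenedettiPetronio1992, §B.1 p. 55 (analytic continuation principle)] -/
theorem eq_of_smul_eventuallyEq (hn : 1 ≤ n) {A B : lorentzGroup F} {p : sphere (0 : F) 1}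
    (h : (fun y : sphere (0 : F) 1 => A • y) =ᶠ[𝓝 p] fun y => B • y) : A = B := by
  have h' : ∀ᶠ y in 𝓝 p, (B⁻¹ * A) • y = y := by
    filter_upwards [h] with y hy
    rw [mul_smul, hy, inv_smul_smul]
  have := eq_one_of_smul_eventuallyEq hn h'
  rwa [inv_mul_eq_one, eq_comm] at this

end Rigid

/-! ### The set of Möbius self-maps of the sphere -/

section MoebiusMaps

variable (F) in
/-- The **Möbius transformations** of the unit sphere of `F`, as a set of self-maps: the maps
`y ↦ A • y`, `A` in the orthochronous Lorentz group of `ℝ × F`. [folklore] -/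
def moebiusMaps : Set (sphere (0 : F) 1 → sphere (0 : F) 1) :=
  Set.range fun A : lorentzGroup F => fun y => A • y

/-- The identity is a Möbius transformation. [folklore] -/
theorem id_mem_moebiusMaps : id ∈ moebiusMaps F :=
  ⟨1, funext fun y => one_smul _ y⟩

/-- Möbius transformations are closed under composition. [folklore] -/
theorem comp_mem_moebiusMaps {g h : sphere (0 : F) 1 → sphere (0 : F) 1} (hg : g ∈ moebiusMaps F)
    (hh : h ∈ moebiusMaps F) : g ∘ h ∈ moebiusMaps F := by
  obtain ⟨A, rfl⟩ := hg
  obtain ⟨B, rfl⟩ := hh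
  exact ⟨A * B, funext fun y => mul_smul A B y⟩

variable {n : ℕ} [Fact (finrank ℝ F = n + 1)]

/-- Möbius transformations are `C^∞` diffeomorphisms of the sphere. [folklore] -/
theorem exists_diffeomorph_of_mem_moebiusMaps {g : sphere (0 : F) 1 → sphere (0 : F) 1}
    (hg : g ∈ moebiusMaps F) :
    ∃ Φ : Diffeomorph (𝓡 n) (𝓡 n) (sphere (0 : F) 1) (sphere (0 : F) 1) ∞, ⇑Φ = g := by
  obtain ⟨A, rfl⟩ := hg
  exact ⟨moebiusDiffeo A, rfl⟩

/-- **Rigidity of the Möbius transformations of `Sⁿ`, `n ≥ 1`**: two of them which agree near a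
point are equal. [cite: BenedettiPetronio1992, §B.1 p. 55 (analytic continuation principle)] -/
theorem moebiusMaps_rigid (hn : 1 ≤ n) {g h : sphere (0 : F) 1 → sphere (0 : F) 1}
    (hg : g ∈ moebiusMaps F) (hh : h ∈ moebiusMaps F) {p : sphere (0 : F) 1} (hgh : g =ᶠ[𝓝 p] h) :
    g = h := by
  obtain ⟨A, rfl⟩ := hg
  obtain ⟨B, rfl⟩ := hh
  rw [eq_of_smul_eventuallyEq hn hgh]

end MoebiusMaps

end Literature.Geometry.Conformal

end
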